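import Summits.CriticalPhenomena.PercolationContinuityZ3.Theorems.PercNearOneGluingNoHeavyQuantIndepBlobCloudSubtypeBridge
import Summits.CriticalPhenomena.PercolationContinuityZ3.Theorems.PercNearOneGluingNoHeavyQuantIndepBlobCantelliRow
import HarnessLib

/-!
# QUANT lane R8, T-DIB: the CANTELLI device for the restricted tail of a sub-cloud

builds on p205010 (kernel theorem, internal audit signed; external expert review pending)

Support file (`--supports stmt-CriticalPhenomena-4575`), QUANT lane seat prim-quant-p1 (gen 12); memo
`run/shared/lean/prim/quant/P1-SURPLUS.md` §23.11–23.12.  Theorems only; no definitions, no sorries, standard axioms.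

`Quant.IndepBlob.one_sub_tailU_le_cantelli`: for a sub-cloud `U` with gates in `[0,1]`, mean open mass `μ_U = Σ_{i∈U} a_i p_i` and
variance `V_U = Σ_{i∈U} a_i² p_i(1−p_i)`, and an integer `u < μ_U`:  `1 − TL_U(u+1) = P(Λ_U ≤ u) ≤ V_U / (V_U + (μ_U − u)²)`.
Proof: the subtype bridge `tailU_eq_subtype_filter` + the lane's finite-sum Cantelli `Quant.bernoulliWeight_cantelli` with the moment
identities of `…IndepBlobMoments` on `↥U`.  This is the third device of the programme of memo §23.11 (with `…CloudDevices`).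
[cite: KozmaNitzan2024, Conjecture 3 (p. 15)] (the gluing rows served); [this work].
-/

namespace Summit.CriticalPhenomena.PercolationContinuityZ3.Theorems

namespace Quant

namespace IndepBlob

open Finset

variable {κ : Type*} [DecidableEq κ]

/-- **Cantelli device for a sub-cloud.**  See the module docstring. [this work] -/
theorem one_sub_tailU_le_cantelli (p : κ → ℝ) (a : κ → ℕ) (U : Finset κ)
    (hp0 : ∀ i ∈ U, 0 ≤ p i) (hp1 : ∀ i ∈ U, p i ≤ 1) (u : ℕ)
    (hmu : (u : ℝ) < ∑ i ∈ U, (a i : ℝ) * p i) :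
    1 - ∑ s ∈ U.powerset, (∏ i ∈ U, (if i ∈ s then p i else 1 - p i)) * (if u + 1 ≤ ∑ i ∈ s, a i then (1 : ℝ) else 0) ≤
      (∑ i ∈ U, (a i : ℝ) ^ 2 * p i * (1 - p i)) /
        ((∑ i ∈ U, (a i : ℝ) ^ 2 * p i * (1 - p i)) + ((∑ i ∈ U, (a i : ℝ) * p i) - u) ^ 2) := by
  rw [tailU_eq_subtype_filter]
  -- the system on the subtype
  set p' : ↥U → ℝ := fun i => p i.1 with hp'
  set a' : ↥U → ℝ := fun i => (a i.1 : ℝ) with ha'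
  have hp0' : ∀ i : ↥U, 0 ≤ p' i := fun i => hp0 i.1 i.2
  have hp1' : ∀ i : ↥U, p' i ≤ 1 := fun i => hp1 i.1 i.2
  set m : ℝ := ∑ i : ↥U, a' i * p' i with hm
  set V : ℝ := ∑ i : ↥U, a' i ^ 2 * p' i * (1 - p' i) with hVdef
  have hmU : m = ∑ i ∈ U, (a i : ℝ) * p i := by
    rw [hm]; exact Finset.sum_coe_sort U (fun i => (a i : ℝ) * p i)
  have hVU : V = ∑ i ∈ U, (a i : ℝ) ^ 2 * p i * (1 - p i) := by
    rw [hVdef]; exact Finset.sum_coe_sort U (fun i => (a i : ℝ) ^ 2 * p i * (1 - p i))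
  -- moments of `X W = Σ_{i∈W} a i`
  have hmean : ∑ W : Finset ↥U, (∏ k, if k ∈ W then p' k else 1 - p' k) * (∑ i ∈ W, a' i) = m :=
    sum_bernoulliWeight_mul_count p' a'
  have hvar : ∑ W : Finset ↥U, (∏ k, if k ∈ W then p' k else 1 - p' k) * ((∑ i ∈ W, a' i) - m) ^ 2 = V := by
    have h2 := sum_bernoulliWeight_mul_sq_sub p' a' m
    have e : ∀ W : Finset ↥U, ((∑ i ∈ W, a' i) - m) ^ 2 = (m - ∑ i ∈ W, a' i) ^ 2 := fun W => by ring
    simp_rw [e]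
    rw [h2, ← hm, sub_self, zero_pow two_ne_zero, zero_add]
  have hmu' : (u : ℝ) < m := by rw [hmU]; exact hmu
  have hcant := bernoulliWeight_cantelli p' hp0' hp1' (fun W => ∑ i ∈ W, a' i) m V (u : ℝ) hmean hvar hmu'
  -- complement: `P(X ≤ u) + P(u + 1 ≤ X) = 1`
  have hL : ∑ W ∈ (Finset.univ : Finset (Finset ↥U)).filter (fun W => (∑ i ∈ W, a' i) ≤ (u : ℝ)),
      (∏ k, if k ∈ W then p' k else 1 - p' k) =
      ∑ W ∈ (Finset.univ : Finset (Finset ↥U)).filter (fun W => ¬ (u + 1 ≤ ∑ i ∈ W, a i.1)),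
        (∏ k, if k ∈ W then p' k else 1 - p' k) := by
    refine Finset.sum_congr (Finset.filter_congr fun W _ => ?_) fun _ _ => rfl
    rw [not_le, Nat.lt_succ_iff]
    have e : (∑ i ∈ W, a' i) = ((∑ i ∈ W, a i.1 : ℕ) : ℝ) := by rw [ha']; push_cast; rfl
    rw [e]
    exact_mod_cast Iff.rfl
  have hcompl := Finset.sum_filter_add_sum_filter_not (Finset.univ : Finset (Finset ↥U))
    (fun W => u + 1 ≤ ∑ i ∈ W, a i.1) (fun W => (∏ k, if k ∈ W then p' k else 1 - p' k))
  rw [sum_bernoulliWeight p'] at hcompl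
  rw [hL] at hcant
  have hp'eval : ∀ W : Finset ↥U, (∏ k, if k ∈ W then p' k else 1 - p' k) = ∏ i : ↥U, (if i ∈ W then p i.1 else 1 - p i.1) :=
    fun W => rfl
  simp_rw [hp'eval] at hcompl hcant
  rw [hVU, hmU] at hcant
  linarith

end IndepBlob

end Quant

end Summit.CriticalPhenomena.PercolationContinuityZ3.Theorems
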